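import Summits.CriticalPhenomena.CardyFormulaZ2.Theorems.CardyBoundaryCoulombGasBoundaryDefectGaussianRStubTransportPathsPart2

/-!
# Stub `stub_transportPaths` of line `rainbow-monomials-in-excursion-kernels` — Part 3:
# the orientation propagates around a rectilinear Jordan frontier
# (crux `CardyBoundaryCoulombGas.BoundaryDefectGaussianR`, stmt-CriticalPhenomena-14132)

(T3/T4, continuum part, conclusion.) With `Sq t` = "the loop `γ = D.boundary` has the interior on
its left at `t`" (inline: for the unit direction `τ` in which `γ` leaves `γ t`, an open square
`γ t + τ (0, ε)²` lies in `D`), and the local lemmas of Part 2: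

* `tp_sq_locally_const` — `Sq` is locally constant (first/second alternative of the wedge);
* `tp_sq_all` — the orientation clause of TRANSPORT at ONE parameter `t₁` (`γ` leaves along `τ`,
  `γ t₁ + s τ i ∈ D` for small `s > 0`) excludes the second alternative at `t₁`, so by
  connectedness of `ℝ` the loop has the interior on its left EVERYWHERE;
* `tp_wedgeAt_oriented` / registered `s7_wedgeOriented` — hence at every parameter the wedge of
  Part 1 holds with the FIRST alternative: near `γ t₀` the domain is the standard sector of `m`
  quadrants swept counter-clockwise from the outgoing ray `i^a` to the incoming ray `i^(a+m)`
  (`m = 1` convex corner, `m = 2` flat point, `m = 3` reflex corner).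
All [folklore].
-/

noncomputable section

open Set Filter Metric Topology
open Literature.Probability.RandomPlanarGeometry
open Summit.CriticalPhenomena.CardyFormulaZ2.Cruxes.RectilinearCardy.ExcursionKernelCovariance

namespace Summit.CriticalPhenomena.CardyFormulaZ2.Cruxes.BoundaryDefectGaussianR.RainbowMonomialsInExcursionKernels

/-! ### Local constancy and propagation of the orientation -/

/-- **`Sq` is locally constant.** Near every parameter `t₀`, either the loop has the interior on
its left at all parameters, or at none (first/second alternative of the wedge at `t₀`).
[folklore] -/
theorem tp_sq_locally_const (D : JordanDomain) {S : Finset (ℂ × ℂ)}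
    (hS : ∀ q ∈ S, q.1.re = q.2.re ∨ q.1.im = q.2.im)
    (hcov : frontier D.carrier ⊆ ⋃ q ∈ S, segment ℝ q.1 q.2) (t₀ : ℝ) :
    ∃ ε : ℝ, 0 < ε ∧
      ((∀ t ∈ Ioo (t₀ - ε) (t₀ + ε), (∃ τ : ℂ, ‖τ‖ = 1 ∧
      (∃ ε : ℝ, 0 < ε ∧ ∀ t' ∈ Ioo t (t + ε), ∃ s : ℝ, 0 < s ∧
        D.boundary t' = D.boundary t + (s : ℂ) * τ) ∧
      (∃ ε : ℝ, 0 < ε ∧ ∀ x ∈ Ioo (0 : ℝ) ε, ∀ y ∈ Ioo (0 : ℝ) ε,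
        D.boundary t + τ * ((x : ℂ) + (y : ℂ) * Complex.I) ∈ D.carrier))) ∨
        (∀ t ∈ Ioo (t₀ - ε) (t₀ + ε), ¬ (∃ τ : ℂ, ‖τ‖ = 1 ∧
      (∃ ε : ℝ, 0 < ε ∧ ∀ t' ∈ Ioo t (t + ε), ∃ s : ℝ, 0 < s ∧
        D.boundary t' = D.boundary t + (s : ℂ) * τ) ∧
      (∃ ε : ℝ, 0 < ε ∧ ∀ x ∈ Ioo (0 : ℝ) ε, ∀ y ∈ Ioo (0 : ℝ) ε,
        D.boundary t + τ * ((x : ℂ) + (y : ℂ) * Complex.I) ∈ D.carrier)))) := by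
  obtain ⟨r, η, a, m, hr, hη, -, -, hm, hdirA, hmonoA, -, hdirB, hantiB, -, -, -, hdich⟩ :=
    tp_wedgeAt D hS hcov t₀
  obtain ⟨δ, hδ, hδr⟩ : ∃ δ > 0, ∀ t, |t - t₀| < δ →
      ‖D.boundary t - D.boundary t₀‖ < r / 2 := by
    have hc : Continuous fun t => ‖D.boundary t - D.boundary t₀‖ := by
      have := D.continuous_boundary; fun_prop
    obtain ⟨δ, hδ, h⟩ :=
      Metric.continuousAt_iff.1 (hc.continuousAt (x := t₀)) (r / 2) (by positivity)
    refine ⟨δ, hδ, fun t ht => ?_⟩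
    have h' := h (by rwa [Real.dist_eq] : dist t t₀ < δ)
    rw [Real.dist_eq, sub_self, norm_zero, sub_zero, abs_norm] at h'
    exact h'
  refine ⟨min δ η, lt_min hδ hη, ?_⟩
  have hwin : ∀ t ∈ Ioo (t₀ - min δ η) (t₀ + min δ η),
      t ∈ Ioo (t₀ - η) (t₀ + η) ∧ ‖D.boundary t - D.boundary t₀‖ < r / 2 := by
    intro t ht
    have h1 := min_le_left δ η
    have h2 := min_le_right δ η
    exact ⟨⟨by linarith [ht.1], by linarith [ht.2]⟩,
      hδr t (by rw [abs_lt]; constructor <;> linarith [ht.1, ht.2])⟩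
  rcases hdich with hfirst | hsecond
  · left
    intro t ht
    obtain ⟨htη, hft⟩ := hwin t ht
    rcases le_or_gt t₀ t with h0 | h0
    · exact tp_sq_of_first_out D hr hdirA hmonoA hfirst ⟨h0, htη.2⟩ hft
    · exact tp_sq_of_first_in D hr hm hdirB hantiB hfirst ⟨htη.1, h0⟩ hft
  · right
    intro t ht
    obtain ⟨htη, hft⟩ := hwin t ht
    exact tp_not_sq_of_second D hr hm hdirA hmonoA hdirB hantiB hsecond htη hft

/-- **The orientation propagates around the loop (T3/T4).** If at ONE parameter `t₁` the loop
leaves `γ t₁` in a unit direction `τ` with `γ t₁ + s τ i ∈ D` for all small `s > 0` (the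
orientation clause of TRANSPORT), then at EVERY parameter the loop has the interior on its left
(`Sq` is locally constant on the connected line, and the clause at `t₁` excludes the second
alternative of the wedge there). [folklore] -/
theorem tp_sq_all (D : JordanDomain) {S : Finset (ℂ × ℂ)}
    (hS : ∀ q ∈ S, q.1.re = q.2.re ∨ q.1.im = q.2.im)
    (hcov : frontier D.carrier ⊆ ⋃ q ∈ S, segment ℝ q.1 q.2) {t₁ : ℝ}
    (hor : (∃ τ : ℂ, ‖τ‖ = 1 ∧
      (∃ ε : ℝ, 0 < ε ∧ ∀ t ∈ Ioo t₁ (t₁ + ε), ∃ s : ℝ, 0 < s ∧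
        D.boundary t = D.boundary t₁ + (s : ℂ) * τ) ∧
      (∃ ε : ℝ, 0 < ε ∧ ∀ s ∈ Ioo (0 : ℝ) ε,
        D.boundary t₁ + (s : ℂ) * (τ * Complex.I) ∈ D.carrier))) (t : ℝ) :
    (∃ τ : ℂ, ‖τ‖ = 1 ∧
      (∃ ε : ℝ, 0 < ε ∧ ∀ t' ∈ Ioo t (t + ε), ∃ s : ℝ, 0 < s ∧
        D.boundary t' = D.boundary t + (s : ℂ) * τ) ∧
      (∃ ε : ℝ, 0 < ε ∧ ∀ x ∈ Ioo (0 : ℝ) ε, ∀ y ∈ Ioo (0 : ℝ) ε,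
        D.boundary t + τ * ((x : ℂ) + (y : ℂ) * Complex.I) ∈ D.carrier)) := by
  -- the set of good parameters is clopen
  have hclopen : IsClopen {t : ℝ | (∃ τ : ℂ, ‖τ‖ = 1 ∧
      (∃ ε : ℝ, 0 < ε ∧ ∀ t' ∈ Ioo t (t + ε), ∃ s : ℝ, 0 < s ∧
        D.boundary t' = D.boundary t + (s : ℂ) * τ) ∧
      (∃ ε : ℝ, 0 < ε ∧ ∀ x ∈ Ioo (0 : ℝ) ε, ∀ y ∈ Ioo (0 : ℝ) ε,
        D.boundary t + τ * ((x : ℂ) + (y : ℂ) * Complex.I) ∈ D.carrier))} := by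
    refine ⟨?_, ?_⟩
    · rw [← isOpen_compl_iff, Metric.isOpen_iff]
      intro t ht
      obtain ⟨ε, hε, h⟩ := tp_sq_locally_const D hS hcov t
      rcases h with h | h
      · exact absurd (h t ⟨by linarith, by linarith⟩) ht
      · refine ⟨ε, hε, fun t' ht' => h t' ?_⟩
        rw [mem_ball, Real.dist_eq, abs_lt] at ht'
        exact ⟨by linarith [ht'.1], by linarith [ht'.2]⟩
    · rw [Metric.isOpen_iff]
      intro t ht
      obtain ⟨ε, hε, h⟩ := tp_sq_locally_const D hS hcov t
      rcases h with h | h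
      · refine ⟨ε, hε, fun t' ht' => h t' ?_⟩
        rw [mem_ball, Real.dist_eq, abs_lt] at ht'
        exact ⟨by linarith [ht'.1], by linarith [ht'.2]⟩
      · exact absurd ht (h t ⟨by linarith, by linarith⟩)
  -- the clause at `t₁` gives a good parameter
  have h1 : t₁ ∈ {t : ℝ | (∃ τ : ℂ, ‖τ‖ = 1 ∧
      (∃ ε : ℝ, 0 < ε ∧ ∀ t' ∈ Ioo t (t + ε), ∃ s : ℝ, 0 < s ∧
        D.boundary t' = D.boundary t + (s : ℂ) * τ) ∧
      (∃ ε : ℝ, 0 < ε ∧ ∀ x ∈ Ioo (0 : ℝ) ε, ∀ y ∈ Ioo (0 : ℝ) ε,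
        D.boundary t + τ * ((x : ℂ) + (y : ℂ) * Complex.I) ∈ D.carrier))} := by
    obtain ⟨r, η, a, m, hr, hη, -, -, hm, hdirA, hmonoA, -, hdirB, hantiB, -, -, -, hdich⟩ :=
      tp_wedgeAt D hS hcov t₁
    rcases hdich with hfirst | hsecond
    · exact tp_sq_of_first_out D hr hdirA hmonoA hfirst ⟨le_rfl, by linarith⟩
        (by rw [sub_self, norm_zero]; positivity)
    · exfalso
      obtain ⟨τ, hτ, ⟨ε, hε, hgerm⟩, ⟨ε', hε', hnormal⟩⟩ := hor
      set γ := D.boundary with hγ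
      set p := γ t₁ with hp
      have htI : t₁ ∈ Icc t₁ (t₁ + η) := ⟨le_rfl, by linarith⟩
      have hτa : τ = Complex.I ^ a := by
        refine tp_dir_unique (γ := γ) hτ (by rw [norm_pow, Complex.norm_I, one_pow]) hε hη hgerm
          fun t' ht' => ?_
        have ht'I : t' ∈ Icc t₁ (t₁ + η) := ⟨ht'.1.le, ht'.2.le⟩
        exact ⟨‖γ t' - p‖ - ‖γ t₁ - p‖, sub_pos.2 (hmonoA htI ht'I ht'.1),
          tp_germ_step (hdirA t₁ htI) (hdirA t' ht'I)⟩
      subst hτa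
      set s := min ε' r / 2 with hs
      have hM : 0 < min ε' r := lt_min hε' hr
      have hs0 : 0 < s := by rw [hs]; linarith
      have hsε : s < ε' := by rw [hs]; linarith [min_le_left ε' r]
      have hsr : s < r := by rw [hs]; linarith [min_le_right ε' r]
      have hzD := hnormal s ⟨hs0, hsε⟩
      set w : ℂ := (s : ℂ) * Complex.I with hw
      have hzp : p + (s : ℂ) * (Complex.I ^ a * Complex.I) - p = Complex.I ^ a * w := by
        rw [hw]; ring
      have hwre : w.re = 0 := by simp [hw]
      have hwim : w.im = s := by simp [hw]
      have hu : (p + (s : ℂ) * (Complex.I ^ a * Complex.I) - p) * (-Complex.I) ^ (a + m) =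
          w * (-Complex.I) ^ m := by
        rw [hzp, tp_frame_turn']
      have hdist : dist (p + (s : ℂ) * (Complex.I ^ a * Complex.I)) p < r := by
        rw [tp_dist_of_frame hzp, hw, norm_mul, Complex.norm_real, Complex.norm_I, mul_one,
          Real.norm_eq_abs, abs_of_pos hs0]
        exact hsr
      have hmem := (hsecond _ hdist).1 hzD
      rw [hu] at hmem
      rcases hm with rfl | rfl | rfl
      · have e1 : (w * (-Complex.I) ^ 1).re = w.im := by simp
        have e2 : (w * (-Complex.I) ^ 1).im = -w.re := by simp
        have h3 := hmem.2.2 (by norm_num)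
        rw [e1, e2, hwre, hwim] at h3
        rcases h3 with h3 | h3 <;> linarith
      · have e2 : (w * (-Complex.I) ^ 2).im = -w.im := by simp
        have h3 := hmem.2.1 (by norm_num)
        rw [e2, hwim] at h3
        linarith
      · have e1 : (w * (-Complex.I) ^ 3).re = -w.im := by simp [pow_succ]
        have h3 := (hmem.1 (by norm_num)).1
        rw [e1, hwim] at h3
        linarith
  have huniv : {t : ℝ | (∃ τ : ℂ, ‖τ‖ = 1 ∧
      (∃ ε : ℝ, 0 < ε ∧ ∀ t' ∈ Ioo t (t + ε), ∃ s : ℝ, 0 < s ∧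
        D.boundary t' = D.boundary t + (s : ℂ) * τ) ∧
      (∃ ε : ℝ, 0 < ε ∧ ∀ x ∈ Ioo (0 : ℝ) ε, ∀ y ∈ Ioo (0 : ℝ) ε,
        D.boundary t + τ * ((x : ℂ) + (y : ℂ) * Complex.I) ∈ D.carrier))} = univ := by
    rcases isClopen_iff.1 hclopen with h | h
    · rw [h] at h1; exact absurd h1 (notMem_empty _)
    · exact h
  have ht : t ∈ {t : ℝ | (∃ τ : ℂ, ‖τ‖ = 1 ∧
      (∃ ε : ℝ, 0 < ε ∧ ∀ t' ∈ Ioo t (t + ε), ∃ s : ℝ, 0 < s ∧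
        D.boundary t' = D.boundary t + (s : ℂ) * τ) ∧
      (∃ ε : ℝ, 0 < ε ∧ ∀ x ∈ Ioo (0 : ℝ) ε, ∀ y ∈ Ioo (0 : ℝ) ε,
        D.boundary t + τ * ((x : ℂ) + (y : ℂ) * Complex.I) ∈ D.carrier))} := by rw [huniv]; exact mem_univ t
  exact ht

/-- **The oriented wedge at every boundary point (T2 + T3).** For a Jordan domain whose frontier
is covered by finitely many axis-parallel segments and whose boundary loop satisfies the
orientation clause of TRANSPORT at one parameter `t₁`: at EVERY parameter `t₀` the conclusions of
`tp_wedgeAt` hold with the FIRST alternative — within `r` of `γ t₀` the domain is the standard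
sector of `m` quadrants swept counter-clockwise from the outgoing ray `i^a` to the incoming ray
`i^(a+m)` (`m = 1`: convex corner, `m = 2`: flat point, `m = 3`: reflex corner). [folklore] -/
theorem tp_wedgeAt_oriented (D : JordanDomain) {S : Finset (ℂ × ℂ)}
    (hS : ∀ q ∈ S, q.1.re = q.2.re ∨ q.1.im = q.2.im)
    (hcov : frontier D.carrier ⊆ ⋃ q ∈ S, segment ℝ q.1 q.2) {t₁ : ℝ}
    (hor : (∃ τ : ℂ, ‖τ‖ = 1 ∧
      (∃ ε : ℝ, 0 < ε ∧ ∀ t ∈ Ioo t₁ (t₁ + ε), ∃ s : ℝ, 0 < s ∧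
        D.boundary t = D.boundary t₁ + (s : ℂ) * τ) ∧
      (∃ ε : ℝ, 0 < ε ∧ ∀ s ∈ Ioo (0 : ℝ) ε,
        D.boundary t₁ + (s : ℂ) * (τ * Complex.I) ∈ D.carrier))) (t₀ : ℝ) :
    ∃ r η : ℝ, ∃ a m : ℕ, 0 < r ∧ 0 < η ∧ η ≤ 1 / 4 ∧ a < 4 ∧ (m = 1 ∨ m = 2 ∨ m = 3) ∧
      (∀ t ∈ Icc t₀ (t₀ + η), D.boundary t =
        D.boundary t₀ + ((‖D.boundary t - D.boundary t₀‖ : ℝ) : ℂ) * Complex.I ^ a) ∧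
      StrictMonoOn (fun t => ‖D.boundary t - D.boundary t₀‖) (Icc t₀ (t₀ + η)) ∧
      r < ‖D.boundary (t₀ + η) - D.boundary t₀‖ ∧
      (∀ t ∈ Icc (t₀ - η) t₀, D.boundary t =
        D.boundary t₀ + ((‖D.boundary t - D.boundary t₀‖ : ℝ) : ℂ) * Complex.I ^ (a + m)) ∧
      StrictAntiOn (fun t => ‖D.boundary t - D.boundary t₀‖) (Icc (t₀ - η) t₀) ∧
      r < ‖D.boundary (t₀ - η) - D.boundary t₀‖ ∧
      (∀ z ∈ frontier D.carrier, dist z (D.boundary t₀) < r →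
        ∃ t ∈ Ioo (t₀ - η) (t₀ + η), z = D.boundary t) ∧
      (∀ z, dist z (D.boundary t₀) < r → (z ∈ frontier D.carrier ↔
        (((z - D.boundary t₀) * (-Complex.I) ^ a).im = 0 ∧
            0 ≤ ((z - D.boundary t₀) * (-Complex.I) ^ a).re) ∨
          (((z - D.boundary t₀) * (-Complex.I) ^ (a + m)).im = 0 ∧
            0 ≤ ((z - D.boundary t₀) * (-Complex.I) ^ (a + m)).re))) ∧
      (∀ z, dist z (D.boundary t₀) < r → (z ∈ D.carrier ↔
          (m = 1 → 0 < ((z - D.boundary t₀) * (-Complex.I) ^ a).re ∧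
              0 < ((z - D.boundary t₀) * (-Complex.I) ^ a).im) ∧
            (m = 2 → 0 < ((z - D.boundary t₀) * (-Complex.I) ^ a).im) ∧
            (m = 3 → 0 < ((z - D.boundary t₀) * (-Complex.I) ^ a).im ∨
              ((z - D.boundary t₀) * (-Complex.I) ^ a).re < 0))) := by
  obtain ⟨r, η, a, m, hr, hη, hη4, ha4, hm, hdirA, hmonoA, hrA, hdirB, hantiB, hrB, hloc, hfront,
    hdich⟩ := tp_wedgeAt D hS hcov t₀
  refine ⟨r, η, a, m, hr, hη, hη4, ha4, hm, hdirA, hmonoA, hrA, hdirB, hantiB, hrB, hloc, hfront,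
    ?_⟩
  rcases hdich with h | h
  · exact h
  · exfalso
    exact tp_not_sq_of_second D hr hm hdirA hmonoA hdirB hantiB h ⟨by linarith, by linarith⟩
      (by rw [sub_self, norm_zero]; positivity) (tp_sq_all D hS hcov hor t₀)

/-- **Registered sub-goal `s7_wedgeOriented` of stub `stub_transportPaths`** (T2 + T3: the oriented
wedge at every boundary point, one-line form of `tp_wedgeAt_oriented`). [folklore] -/
theorem s7_wedgeOriented : ∀ (D : Literature.Probability.RandomPlanarGeometry.JordanDomain) (S : Finset (ℂ × ℂ)), (∀ q ∈ S, q.1.re = q.2.re ∨ q.1.im = q.2.im) → frontier D.carrier ⊆ ⋃ q ∈ S, segment ℝ q.1 q.2 → ∀ (t₁ : ℝ), (∃ τ : ℂ, ‖τ‖ = 1 ∧ (∃ ε : ℝ, 0 < ε ∧ ∀ t ∈ Set.Ioo t₁ (t₁ + ε), ∃ s : ℝ, 0 < s ∧ D.boundary t = D.boundary t₁ + (s : ℂ) * τ) ∧ (∃ ε : ℝ, 0 < ε ∧ ∀ s ∈ Set.Ioo (0 : ℝ) ε, D.boundary t₁ + (s : ℂ) * (τ * Complex.I) ∈ D.carrier))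 → ∀ (t₀ : ℝ), ∃ r η : ℝ, ∃ a m : ℕ, 0 < r ∧ 0 < η ∧ η ≤ 1 / 4 ∧ a < 4 ∧ (m = 1 ∨ m = 2 ∨ m = 3) ∧ (∀ t ∈ Set.Icc t₀ (t₀ + η), D.boundary t = D.boundary t₀ + ((‖D.boundary t - D.boundary t₀‖ : ℝ) : ℂ) * Complex.I ^ a) ∧ StrictMonoOn (fun t ↦ ‖D.boundary t - D.boundary t₀‖) (Set.Icc t₀ (t₀ + η)) ∧ r < ‖D.boundary (t₀ + η) - D.boundary t₀‖ ∧ (∀ t ∈ Set.Icc (t₀ - η) t₀, D.boundary t = D.boundary t₀ + ((‖D.boundary t - D.boundary t₀‖ : ℝ) : ℂ) * Complex.I ^ (a + m)) ∧ StrictAntiOn (fun t ↦ ‖D.boundary t - D.boundary t₀‖) (Set.Icc (t₀ - η) t₀) ∧ r < ‖D.boundary (t₀ - η) - D.boundary t₀‖ ∧ (∀ z ∈ frontier D.carrier, dist z (D.boundary t₀) < r → ∃ t ∈ Set.Ioo (t₀ - η) (t₀ + η), z = D.boundary t) ∧ (∀ z, dist z (D.boundary t₀) < r → (z ∈ frontier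 D.carrier ↔ (((z - D.boundary t₀) * (-Complex.I) ^ a).im = 0 ∧ 0 ≤ ((z - D.boundary t₀) * (-Complex.I) ^ a).re) ∨ (((z - D.boundary t₀) * (-Complex.I) ^ (a + m)).im = 0 ∧ 0 ≤ ((z - D.boundary t₀) * (-Complex.I) ^ (a + m)).re))) ∧ (∀ z, dist z (D.boundary t₀) < r → (z ∈ D.carrier ↔ (m = 1 → 0 < ((z - D.boundary t₀) * (-Complex.I) ^ a).re ∧ 0 < ((z - D.boundary t₀) * (-Complex.I) ^ a).im) ∧ (m = 2 → 0 < ((z - D.boundary t₀) * (-Complex.I) ^ a).im) ∧ (m = 3 → 0 < ((z - D.boundary t₀) * (-Complex.I) ^ a).im ∨ ((z - D.boundary t₀) * (-Complex.I) ^ a).re < 0))) :=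
  fun D _ hS hcov _ hor t₀ => tp_wedgeAt_oriented D hS hcov hor t₀

end Summit.CriticalPhenomena.CardyFormulaZ2.Cruxes.BoundaryDefectGaussianR.RainbowMonomialsInExcursionKernels

end
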